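import Summits.ABC.StewartYu.DescentThirdLiouvilleQ
import Summits.ABC.StewartYu.PadicMulticubicLiouvilleRat
import HarnessLib

/-!
# Cell abc-stewartyu, F-two (crux `Y07Two`, stmt-ABC-19659): the `2`-adic THIRD-POINT Liouville step
# for RATIONAL generators (no integrality hypothesis)

`Summits/ABC/StewartYu/DescentThirdLiouvilleRatQ.lean` — cell `abc-stewartyu` (HOME
`run/shared/lean/pub/abc-stewartyu/`, seat p3 (g4), F-two lead; route `PadicPrimesKummerThird`; theorems only,
no named fact).  The `W80Two` chain (crux stmt-ABC-19486) carried the integrality of the generators as a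
hypothesis `hint : ∀ i, ∃ a : ℤ, allᵢ = a` because lit's multicubic Liouville inequality in use was the INTEGER one
(`MulticubLiouville.norm_ev3_ge_padic`, threshold `1/(6DM·∏ max(1,|αⱼ|))^{3^{k+1}−1}`).  The Gen-3 engine at
`p = 2` runs a Matveev induction whose new generators `θᵢ = ∏ αⱼ^{zᵢⱼ}` are RATIONAL principal units, no longer
integers (HOME/p3/memo-08 §3 (T3)); this file is the announced "library upgrade" of the third-point step to
lit's RATIONAL inequality `MulticubLiouville.norm_ev3_ge_padic_rat` (threshold with the height product
`P(α)⁵ = (∏ⱼ max(|num αⱼ|, den αⱼ))⁵`, `CW77.heightProd`):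

* `SetupQ.classVec3_eq_zero_of_padicNorm_lt_rat` — place-free twin of
  `SetupQ.classVec3_eq_zero_of_padicNorm_lt` WITHOUT `hint`: if `ev3 t (classVec3 box pv c s)` is
  `p`-adically smaller than `1/(6·D·M·P(all)⁵)^{3^{d+2}−1}`, all `3^{d+1}` triadic class sums vanish;
* `TwoSetup.classVec3_eq_zero_of_norm_Φ_third_lt_rat` — the same at `p = 2` with the principal cube roots
  `cbrtᵢ` and the smallness stated for `‖φ_{J,τ}(s/3)‖₂` — the `third`-hypothesis of p2's algebraic third
  step `SetupQ.descent_algebra3`, now for rational generators.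

Everything is [folklore] (Yu 1990 §1.1/§2.4 at `q = 3`; Waldschmidt 1980 Lemma 3.7).

## References
* [Yu1990] K. Yu, *Linear forms in p-adic logarithms II*, Compositio Math. 74 (1990), §1.1, Lemma 2.5.
* [Waldschmidt1980] M. Waldschmidt, Acta Arith. 37 (1980), Lemma 3.7 (pp. 272–273).
-/

noncomputable section

open Finset
open Literature.NumberTheory.Transcendental
open Literature.NumberTheory.Transcendental.CW77 (heightProd)
open Literature.NumberTheory.Transcendental.CW77.Setup (Idx Tau tauNorm)

namespace Summit.ABC.StewartYu

namespace SetupQ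

variable (Q : SetupQ) {h Lb : ℕ}

section Padic

variable {p : ℕ} [Fact p.Prime]

/-- **Third-point Liouville step for RATIONAL generators** (place-free): for generators `allᵢ ∈ ℚ` with
the cube-Kummer condition and `p`-adic cube roots `tᵢ³ = allᵢ`, `‖tᵢ‖_p ≤ 1`, if the evaluation of the
class-sum vector (a denominator `D ≥ 1` of the weights `c(u)·qEt(u,s)` on the box,
`∑_κ |classVec3(κ)| ≤ M`, `M ≥ 1`) is `p`-adically smaller than `1/(6·D·M·P(all)⁵)^{3^{d+2}−1}`,
`P(all) = ∏ᵢ max(|num allᵢ|, den allᵢ)`, then every class sum vanishes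
(`MulticubLiouville.norm_ev3_ge_padic_rat`). [folklore] -/
theorem classVec3_eq_zero_of_padicNorm_lt_rat
    (hind : ∀ κ : Fin (Q.d + 1) → ℕ, (∃ j, ¬ 3 ∣ κ j) → ∀ γ : ℚ, ∏ j, Q.all j ^ κ j ≠ γ ^ 3)
    (t : Fin (Q.d + 1) → ℚ_[p]) (ht : ∀ i, t i ^ 3 = (Q.all i : ℚ_[p])) (ht1 : ∀ i, ‖t i‖ ≤ 1)
    (box : Finset (Idx Q.d h Lb)) (pv : Idx Q.d h Lb → ℤ) (c : Idx Q.d h Lb → ℚ) (s : ℕ)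
    {D : ℕ} (hD : 1 ≤ D) (hDc : ∀ u ∈ box, ∃ z : ℤ, (D : ℚ) * (c u * Q.qEt u s) = z)
    {M : ℝ} (hM : 1 ≤ M) (hcM : ∑ κ, |(Q.classVec3 box pv c s κ : ℝ)| ≤ M)
    (hlt : ‖Multicub.ev3 t (Q.classVec3 box pv c s)‖ <
      1 / (6 * (D : ℝ) * M * heightProd Q.all ^ 5) ^ (3 ^ (Q.d + 1 + 1) - 1)) :
    Q.classVec3 box pv c s = 0 := by
  by_contra hne
  have hge := MulticubLiouville.norm_ev3_ge_padic_rat (p := p) (Q.d + 1) Q.all hind t ht ht1 _ hne D hD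
    (fun κ => Q.classVec3_den box pv c s hDc κ) M hM hcM
  exact absurd hge (not_le.mpr hlt)

end Padic

end SetupQ

namespace TwoSetup

variable (S : TwoSetup) {h Lb : ℕ}

/-- **The `2`-adic third step's Liouville hypothesis, discharged for RATIONAL generators**: for a `2`-adic
set-up `S` (lit's `TwoSetup`: principal units `≡ 1 (mod 8)`, principal cube roots `cbrtᵢ`) with the
cube-Kummer condition; if the weights `qΔ3_{J₀,J+1}(u;τ₀,s)·qA(u,τ')` times `qEt(u,s)` have the denominator
`D ≥ 1` on the box, `∑_κ |classVec3(κ)| ≤ M` (`M ≥ 1`) and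
`‖φ_{J,τ}(s/3)‖₂ < 1/(6·D·M·P(all)⁵)^{3^{d+2}−1}`, then the triadic class-sum vector at `(J+1, τ, s)`
vanishes — the `third`-hypothesis of the algebraic third step, with NO integrality of the generators.
[folklore] -/
theorem classVec3_eq_zero_of_norm_Φ_third_lt_rat
    (hind : ∀ κ : Fin (S.d + 1) → ℕ, (∃ j, ¬ 3 ∣ κ j) → ∀ γ : ℚ, ∏ j, S.toQ.all j ^ κ j ≠ γ ^ 3)
    {J₀ J : ℕ} (hJ : J < J₀) (box : Finset (Idx S.d h Lb)) (pv : Idx S.d h Lb → ℤ) (τ : Tau S.d)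
    (s : ℕ) {D : ℕ} (hD : 1 ≤ D)
    (hDc : ∀ u ∈ box, ∃ z : ℤ, (D : ℚ) *
      ((S.toQ.qΔ3 J₀ (J + 1) u τ.1 s * S.frame.qA u τ.2) * S.toQ.qEt u s) = z)
    {M : ℝ} (hM : 1 ≤ M)
    (hcM : ∑ κ, |(S.toQ.classVec3 box pv
      (fun u => S.toQ.qΔ3 J₀ (J + 1) u τ.1 s * S.frame.qA u τ.2) s κ : ℝ)| ≤ M)
    (hlt : ‖S.Φ J₀ J box pv τ ((s : ℚ_[2]) * ((3 : ℕ) : ℚ_[2])⁻¹)‖ <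
      1 / (6 * (D : ℝ) * M * heightProd S.toQ.all ^ 5) ^ (3 ^ (S.d + 1 + 1) - 1)) :
    S.toQ.classVec3 box pv (fun u => S.toQ.qΔ3 J₀ (J + 1) u τ.1 s * S.frame.qA u τ.2) s = 0 := by
  rw [S.norm_Φ_third hJ] at hlt
  exact S.toQ.classVec3_eq_zero_of_padicNorm_lt_rat hind S.cbrt S.cbrt_pow_three_cast S.norm_cbrt_le_one
    box pv _ s hD hDc hM hcM hlt

end TwoSetup

end Summit.ABC.StewartYu

end
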